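import Literature.Analysis.FluidPDE.NSAnalyticityRadiusLinfty
import Literature.Analysis.Complex.CauchyTaylorBall
import Literature.Analysis.Complex.HolomorphicFramesOfKernels
import Mathlib.Analysis.Calculus.ParametricIntegral
import Mathlib.Analysis.SpecialFunctions.JapaneseBracket
import Mathlib.Analysis.SpecialFunctions.Pow.Integral
import Mathlib.MeasureTheory.Measure.Haar.InnerProductSpace
import HarnessLib

/-!
# Hypersingular second-difference integrals preserve bounded tube holomorphy

Topic `Analysis/FluidPDE` (next to the complex tubes `complexTube` of `NSAnalyticityRadiusLinfty.lean`).
Theorems only: no definitions, no named facts, no `sorry`.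

The analytic input of the «spread» step of the Navier–Stokes door lines S20/S21-C (nsreg-lit LIT-PACK
§R89 (C)) is the following piece of classical several-complex-variables analysis.  Let
`K : ℝ³ → ℝ` be a measurable kernel with `|K z| ≤ A ‖z‖⁻⁴` (the kernel `π⁻²‖z‖⁻⁴` of `Λ = (−Δ)^{1/2}`
in second-difference form is the example), and let `f : ℝ³ → ℝ^κ` be the restriction of a map `U`
holomorphic and bounded (`‖U‖ ≤ B`) on the complex tube `complexTube (Fin 3) r = {x + iy : ‖y‖ < r}`,
`U (complexify x) = complexify (f x)`.  Then the second-difference integral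
`Λ_K f (x) = ∫ K z • (2 f x − f (x+z) − f (x−z)) dz` is again the restriction of a map `V` holomorphic
on the half tube `complexTube (Fin 3) (r/2)`, bounded there by `C(r)·A·B`, and in particular `Λ_K f`
is real-analytic on all of `ℝ³`:

* `exists_tube_extension_secondDiffIntegral` — the tube extension `V` with its bound and the
  integrability of the real integrand;
* `analyticOnNhd_secondDiffIntegral_of_tube` — `AnalyticOnNhd ℝ (fun x => c • ∫ K z • (2 f x − f(x+z) − f(x−z))) univ`.

Proof (Cauchy estimates; the tube/strip stability of uniformly analytic classes under Fourier
multipliers of finite order is classical — the complexified-extension frame is that of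
Grujić–Kukavica 1998 / Guberović 2010, whose theorem `guberovic2010_analyticity_radius_holds` supplies
the tube datum in the consumer): on complex lines `w ↦ U(z + w e)` (`e ∈ ℝ³` a unit vector; the
imaginary part does not move, so the line stays in the tube for `|w| < r − ‖Im z‖`) the one-variable
Taylor estimate of `CauchyTaylorBall.lean` gives the second difference
`‖2U(z) − U(z+y) − U(z−y)‖ ≤ 16 B ‖y‖²/ρ²` for real `‖y‖ ≤ ρ/4`; with the trivial bound `4B` for large
`y` the integrand has the majorant `A(16B/ρ²)‖y‖⁻²` near `0` / `4AB‖y‖⁻⁴` far, integrable on `ℝ³`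
(Mathlib `integrableOn_ball_of_norm_le_rpow`, `integrable_one_add_norm`); the same for the Fréchet
derivative `DU` (holomorphic by the vector-valued Osgood lemma of `HolomorphicFramesOfKernels.lean`,
bounded on smaller tubes by Cauchy's estimate) lets one differentiate under the integral sign
(`hasFDerivAt_integral_of_dominated_of_fderiv_le` over `ℂ`); at real points the integral is the
complexification of the real one (`LinearIsometry.integral_comp_comm`), and holomorphy on the open
half tube gives real-analyticity of the restriction (Osgood again, `restrictScalars`, composition with
the real-linear isometry `complexify` and its real-linear left inverse).
-/

noncomputable section

open MeasureTheory Set Function Filter Metric TopologicalSpace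
open _root_.Topology
open scoped ENNReal NNReal
open Literature.Analysis.FunctionSpaces.EuclideanSpace (complexify complexify_apply norm_complexify
  complexify_injective continuous_complexify)

namespace Literature.Analysis.FluidPDE

/-! ### Tube geometry: real shifts and small complex perturbations -/

section TubeGeometry

variable {ι : Type*} [Fintype ι]

/-- Real translates stay in the tube: `z ∈ T_ρ ⇒ z + y ∈ T_ρ` for real `y` (the tube
`D_t = {x + iy : |y| < r}` is invariant under real translations).
[cite: BradshawGrujicKukavica2016, Thm. 2.4.1 (the tube region `D_t`; elementary property)] -/
theorem add_complexify_mem_complexTube {ρ : ℝ} {z : EuclideanSpace ℂ ι} (hz : z ∈ complexTube ι ρ)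
    (y : EuclideanSpace ℝ ι) : z + complexify y ∈ complexTube ι ρ := by
  obtain ⟨x, y', hy', rfl⟩ := hz
  exact ⟨x + y, y', hy', by rw [map_add]; abel⟩

/-- Real translates stay in the tube: `z ∈ T_ρ ⇒ z − y ∈ T_ρ` for real `y`.
[cite: BradshawGrujicKukavica2016, Thm. 2.4.1 (the tube region `D_t`; elementary property)] -/
theorem sub_complexify_mem_complexTube {ρ : ℝ} {z : EuclideanSpace ℂ ι} (hz : z ∈ complexTube ι ρ)
    (y : EuclideanSpace ℝ ι) : z - complexify y ∈ complexTube ι ρ := by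
  obtain ⟨x, y', hy', rfl⟩ := hz
  exact ⟨x - y, y', hy', by rw [map_sub]; abel⟩

/-- The imaginary part of `h ∈ ℂ^ι` has norm at most `‖h‖`: if `h = complexify a + I • complexify b`
then `‖b‖ ≤ ‖h‖`. [folklore] -/
private theorem norm_im_le_of_eq_complexify_add {h : EuclideanSpace ℂ ι} {a b : EuclideanSpace ℝ ι}
    (hab : h = complexify a + Complex.I • complexify b) : ‖b‖ ≤ ‖h‖ := by
  have hb : ∀ i, b i = (h i).im := fun i => by
    rw [hab, im_complexify_add_I_smul_complexify_apply]
  rw [EuclideanSpace.norm_eq b, EuclideanSpace.norm_eq h]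
  refine Real.sqrt_le_sqrt (Finset.sum_le_sum fun i _ => ?_)
  rw [hb i, Real.norm_eq_abs]
  exact pow_le_pow_left₀ (abs_nonneg _) (Complex.abs_im_le_norm _) 2

/-- Complex perturbations move the tube radius by at most their norm:
`z ∈ T_ρ`, `‖h‖ < δ` ⇒ `z + h ∈ T_{ρ+δ}` (the imaginary part of `h` has norm `≤ ‖h‖`).
[cite: BradshawGrujicKukavica2016, Thm. 2.4.1 (the tube region `D_t`; elementary property)] -/
theorem add_mem_complexTube_of_norm_lt {ρ δ : ℝ} {z h : EuclideanSpace ℂ ι} (hz : z ∈ complexTube ι ρ)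
    (hh : ‖h‖ < δ) : z + h ∈ complexTube ι (ρ + δ) := by
  obtain ⟨x, y, hy, rfl⟩ := hz
  obtain ⟨a, b, hab, -, -⟩ := exists_eq_complexify_add_I_smul_complexify h
  have hbn : ‖b‖ ≤ ‖h‖ := norm_im_le_of_eq_complexify_add hab
  refine ⟨x + a, y + b, (norm_add_le _ _).trans_lt (add_lt_add hy (hbn.trans_lt hh)), ?_⟩
  rw [hab, map_add, map_add, smul_add]
  abel

/-- Real scalars act on `complexify y` through the coercion `ℝ → ℂ`:
`complexify (t • y) = (t : ℂ) • complexify y`. [folklore] -/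
private theorem complexify_smul_real (t : ℝ) (y : EuclideanSpace ℝ ι) :
    complexify (t • y) = (t : ℂ) • complexify y := by
  ext i
  simp [complexify_apply]

end TubeGeometry

/-! ### Cauchy estimates on complex lines inside a tube -/

section Cauchy

variable {ι : Type*} [Fintype ι] {F : Type*} [NormedAddCommGroup F] [NormedSpace ℂ F] [CompleteSpace F]

/-- The complex line `w ↦ z + w • h` through `z ∈ T_ρ` in a direction `‖h‖ ≤ 1` stays in `T_R` for
`|w| < R − ρ`. [folklore] -/
private theorem line_mem_complexTube {R ρ : ℝ} {z h : EuclideanSpace ℂ ι} (hz : z ∈ complexTube ι ρ)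
    (hh : ‖h‖ ≤ 1) {w : ℂ} (hw : w ∈ ball (0 : ℂ) (R - ρ)) : z + w • h ∈ complexTube ι R := by
  have hwn : ‖w • h‖ < R - ρ := by
    rw [norm_smul]
    rw [mem_ball_zero_iff] at hw
    calc ‖w‖ * ‖h‖ ≤ ‖w‖ * 1 := mul_le_mul_of_nonneg_left hh (norm_nonneg _)
      _ < R - ρ := by rw [mul_one]; exact hw
  have := add_mem_complexTube_of_norm_lt hz hwn
  rwa [add_sub_cancel] at this

omit [CompleteSpace F] in
/-- A map holomorphic on `T_R` restricted to a complex line through `z ∈ T_ρ` (`ρ < R`, direction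
`‖h‖ ≤ 1`) is holomorphic on the disc `|w| < R − ρ`. [folklore] -/
private theorem differentiableOn_line {R ρ : ℝ} {W : EuclideanSpace ℂ ι → F}
    (hW : DifferentiableOn ℂ W (complexTube ι R)) {z h : EuclideanSpace ℂ ι} (hz : z ∈ complexTube ι ρ)
    (hh : ‖h‖ ≤ 1) : DifferentiableOn ℂ (fun w : ℂ => W (z + w • h)) (ball (0 : ℂ) (R - ρ)) := by
  intro w hw
  have hWd : DifferentiableAt ℂ W (z + w • h) :=
    hW.differentiableAt ((isOpen_complexTube R).mem_nhds (line_mem_complexTube hz hh hw))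
  exact (hWd.comp w ((differentiableAt_id.smul_const h).const_add z)).differentiableWithinAt

/-- **Cauchy's estimate for the Fréchet derivative on a smaller tube**: if `W` is holomorphic on
`T_R` with `‖W‖ ≤ M` there and `ρ < R`, then `‖DW(z)‖ ≤ 2M/(R − ρ)` for `z ∈ T_ρ` (Cauchy's inequality on
the complex lines `w ↦ z + w h`, `‖h‖ = 1`, which stay in `T_R` for `|w| < R − ρ`).
[cite: HormanderSCV1973, Thm 2.2.7 (Cauchy's inequalities)] -/
theorem norm_fderiv_le_of_tube {R ρ M : ℝ} (hρR : ρ < R) {W : EuclideanSpace ℂ ι → F}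
    (hW : DifferentiableOn ℂ W (complexTube ι R)) (hM : ∀ z ∈ complexTube ι R, ‖W z‖ ≤ M)
    {z : EuclideanSpace ℂ ι} (hz : z ∈ complexTube ι ρ) : ‖fderiv ℂ W z‖ ≤ 2 * M / (R - ρ) := by
  have hRρ : 0 < R - ρ := sub_pos.2 hρR
  have hzR : z ∈ complexTube ι R := complexTube_mono hρR.le hz
  have hM0 : 0 ≤ M := (norm_nonneg _).trans (hM z hzR)
  refine ContinuousLinearMap.opNorm_le_of_unit_norm (by positivity) fun h hh => ?_
  have hφd := differentiableOn_line hW hz hh.le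
  have hφM : ∀ w ∈ ball (0 : ℂ) (R - ρ), ‖W (z + w • h)‖ ≤ M :=
    fun w hw => hM _ (line_mem_complexTube hz hh.le hw)
  have hkey := Literature.Analysis.Complex.norm_deriv_le_of_forall_mem_ball hRρ hφd hφM
  have hWd : HasFDerivAt W (fderiv ℂ W z) (z + (0 : ℂ) • h) := by
    rw [zero_smul, add_zero]
    exact (hW.differentiableAt ((isOpen_complexTube R).mem_nhds hzR)).hasFDerivAt
  have hl : HasDerivAt (fun w : ℂ => z + w • h) h 0 := by
    simpa using ((hasDerivAt_id (0 : ℂ)).smul_const h).const_add z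
  have hcomp : HasDerivAt (fun w : ℂ => W (z + w • h)) (fderiv ℂ W z h) 0 := hWd.comp_hasDerivAt (0 : ℂ) hl
  rw [← hcomp.deriv]
  exact hkey

/-- **Second differences along real directions** (one-variable Taylor estimate on the complex line
through `z` in the direction `y/‖y‖`): if `W` is holomorphic on `T_R` with `‖W‖ ≤ M`, `ρ < R`,
`z ∈ T_ρ` and `y ∈ ℝ^ι` with `‖y‖ ≤ (R − ρ)/4`, then
`‖2W(z) − W(z + y) − W(z − y)‖ ≤ 16 M ‖y‖² / (R − ρ)²` (the order-two Taylor remainders at `±‖y‖` of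
`Literature.Analysis.Complex.norm_sub_sub_le_of_forall_mem_ball`, added).
[cite: HormanderSCV1973, Thm 2.2.7 (Cauchy's inequalities)] -/
theorem norm_secondDiff_le_of_tube {R ρ M : ℝ} (hρR : ρ < R) {W : EuclideanSpace ℂ ι → F}
    (hW : DifferentiableOn ℂ W (complexTube ι R)) (hM : ∀ z ∈ complexTube ι R, ‖W z‖ ≤ M)
    {z : EuclideanSpace ℂ ι} (hz : z ∈ complexTube ι ρ) {y : EuclideanSpace ℝ ι}
    (hy : ‖y‖ ≤ (R - ρ) / 4) :
    ‖(2 : ℂ) • W z - W (z + complexify y) - W (z - complexify y)‖ ≤ 16 * M * ‖y‖ ^ 2 / (R - ρ) ^ 2 := by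
  have hRρ : 0 < R - ρ := sub_pos.2 hρR
  have hzR : z ∈ complexTube ι R := complexTube_mono hρR.le hz
  have hM0 : 0 ≤ M := (norm_nonneg _).trans (hM z hzR)
  by_cases hy0 : y = 0
  · subst hy0
    simp only [map_zero, add_zero, sub_zero, two_smul, add_sub_cancel_right, sub_self, norm_zero]
    positivity
  have hypos : 0 < ‖y‖ := norm_pos_iff.2 hy0
  -- the unit direction and the line
  have he : ‖complexify (‖y‖⁻¹ • y)‖ ≤ 1 := by
    rw [norm_complexify, norm_smul, norm_inv, norm_norm, inv_mul_cancel₀ hypos.ne']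
  have hye : complexify y = ((‖y‖ : ℝ) : ℂ) • complexify (‖y‖⁻¹ • y) := by
    rw [← complexify_smul_real, smul_inv_smul₀ hypos.ne']
  have hφd := differentiableOn_line hW hz he
  have hφM : ∀ w ∈ ball (0 : ℂ) (R - ρ), ‖W (z + w • complexify (‖y‖⁻¹ • y))‖ ≤ M :=
    fun w hw => hM _ (line_mem_complexTube hz he hw)
  have ht : ‖((‖y‖ : ℝ) : ℂ) - 0‖ ≤ (R - ρ) / 4 := by
    simpa [Complex.norm_real, abs_of_nonneg hypos.le] using hy
  have ht' : ‖-((‖y‖ : ℝ) : ℂ) - 0‖ ≤ (R - ρ) / 4 := by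
    simpa [Complex.norm_real, abs_of_nonneg hypos.le] using hy
  have h1 := Literature.Analysis.Complex.norm_sub_sub_le_of_forall_mem_ball hRρ hφd hφM ht
  have h2 := Literature.Analysis.Complex.norm_sub_sub_le_of_forall_mem_ball hRρ hφd hφM ht'
  have en : ‖((‖y‖ : ℝ) : ℂ) - 0‖ = ‖y‖ := by simp [Complex.norm_real]
  have en' : ‖-((‖y‖ : ℝ) : ℂ) - 0‖ = ‖y‖ := by simp [Complex.norm_real]
  rw [en] at h1
  rw [en'] at h2
  simp only [zero_smul, add_zero, sub_zero] at h1 h2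
  rw [← hye] at h1
  rw [neg_smul, ← hye, ← sub_eq_add_neg] at h2
  -- combine
  have hsum : (2 : ℂ) • W z - W (z + complexify y) - W (z - complexify y) =
      -((W (z + complexify y) - W z - ((‖y‖ : ℝ) : ℂ) • deriv (fun w : ℂ => W (z + w • complexify (‖y‖⁻¹ • y))) 0) +
        (W (z - complexify y) - W z - (-((‖y‖ : ℝ) : ℂ)) • deriv (fun w : ℂ => W (z + w • complexify (‖y‖⁻¹ • y))) 0)) := by
    rw [neg_smul, two_smul]
    abel
  rw [hsum, norm_neg]
  refine (norm_add_le _ _).trans ?_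
  have e16 : 16 * M * ‖y‖ ^ 2 / (R - ρ) ^ 2 = 8 * M * ‖y‖ ^ 2 / (R - ρ) ^ 2 + 8 * M * ‖y‖ ^ 2 / (R - ρ) ^ 2 := by
    ring
  rw [e16]
  exact add_le_add h1 h2

end Cauchy

/-! ### The majorant on `ℝ³` -/

section Majorant

/-- For `t ≥ ρ > 0`: `t⁻⁴ ≤ (1 + ρ⁻¹)⁴ (1 + t)⁻⁴`. [folklore] -/
private theorem rpow_neg_four_le {ρ t : ℝ} (hρ : 0 < ρ) (ht : ρ ≤ t) :
    t ^ (-(4 : ℝ)) ≤ (1 + ρ⁻¹) ^ (4 : ℝ) * (1 + t) ^ (-(4 : ℝ)) := by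
  have ht0 : 0 < t := hρ.trans_le ht
  have h1 : 1 + t ≤ (1 + ρ⁻¹) * t := by
    have : 1 ≤ ρ⁻¹ * t := by
      rw [inv_mul_eq_div, le_div_iff₀ hρ, one_mul]
      exact ht
    nlinarith
  have h2 : (1 + t) ^ (4 : ℝ) ≤ (1 + ρ⁻¹) ^ (4 : ℝ) * t ^ (4 : ℝ) := by
    rw [← Real.mul_rpow (by positivity) ht0.le]
    exact Real.rpow_le_rpow (by positivity) h1 (by norm_num)
  have ht4 : 0 < t ^ (4 : ℝ) := Real.rpow_pos_of_pos ht0 _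
  have h1t4 : 0 < (1 + t) ^ (4 : ℝ) := Real.rpow_pos_of_pos (by positivity) _
  rw [Real.rpow_neg ht0.le, Real.rpow_neg (by positivity)]
  calc (t ^ (4 : ℝ))⁻¹ = ((t ^ (4 : ℝ))⁻¹ * (1 + t) ^ (4 : ℝ)) * ((1 + t) ^ (4 : ℝ))⁻¹ := by
        rw [mul_assoc, mul_inv_cancel₀ h1t4.ne', mul_one]
    _ ≤ (1 + ρ⁻¹) ^ (4 : ℝ) * ((1 + t) ^ (4 : ℝ))⁻¹ := by
        refine mul_le_mul_of_nonneg_right ?_ (inv_nonneg.2 h1t4.le)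
        rw [inv_mul_le_iff₀ ht4, mul_comm]
        exact h2

/-- The majorant `a ‖y‖⁻²` on `B_ρ` / `b ‖y‖⁻⁴` off `B_ρ` is integrable on `ℝ³` (`2 < 3 < 4`). [folklore] -/
private theorem integrable_ballIndicator_rpow_neg (a b : ℝ) {ρ : ℝ} (hρ : 0 < ρ) :
    Integrable (fun y : EuclideanSpace ℝ (Fin 3) =>
      (ball (0 : EuclideanSpace ℝ (Fin 3)) ρ).indicator (fun y => a * ‖y‖ ^ (-(2 : ℝ))) y +
        (ball (0 : EuclideanSpace ℝ (Fin 3)) ρ)ᶜ.indicator (fun y => b * ‖y‖ ^ (-(4 : ℝ))) y) volume := by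
  have hn3 : Module.finrank ℝ (EuclideanSpace ℝ (Fin 3)) = 3 := by simp
  refine Integrable.add ?_ ?_
  · rw [integrable_indicator_iff measurableSet_ball]
    refine integrableOn_ball_of_norm_le_rpow (by rw [hn3]; norm_num) (C := |a|) (α := 2)
      (by rw [hn3]; norm_num) (ae_of_all _ fun y => ?_) ?_
    · rw [norm_mul, Real.norm_eq_abs, Real.norm_eq_abs,
        abs_of_nonneg (Real.rpow_nonneg (norm_nonneg _) _)]
    · exact (by fun_prop : Measurable fun y : EuclideanSpace ℝ (Fin 3) =>
        a * ‖y‖ ^ (-(2 : ℝ))).aestronglyMeasurable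
  · rw [integrable_indicator_iff measurableSet_ball.compl]
    have hint : Integrable (fun y : EuclideanSpace ℝ (Fin 3) => (1 + ‖y‖) ^ (-(4 : ℝ))) volume :=
      integrable_one_add_norm (by rw [hn3]; norm_num)
    refine ((hint.const_mul (|b| * (1 + ρ⁻¹) ^ (4 : ℝ))).integrableOn).mono' ?_ ?_
    · exact (by fun_prop : Measurable fun y : EuclideanSpace ℝ (Fin 3) =>
        b * ‖y‖ ^ (-(4 : ℝ))).aestronglyMeasurable
    · refine (ae_restrict_iff' measurableSet_ball.compl).2 (ae_of_all _ fun y hy => ?_)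
      have hy' : ρ ≤ ‖y‖ := by simpa [mem_ball_zero_iff] using hy
      rw [norm_mul, Real.norm_eq_abs, Real.norm_eq_abs,
        abs_of_nonneg (Real.rpow_nonneg (norm_nonneg _) _), mul_assoc]
      exact mul_le_mul_of_nonneg_left (rpow_neg_four_le hρ hy') (abs_nonneg _)

/-- **Pointwise majorant**: if `|K y| ≤ A‖y‖⁻⁴` (`A ≥ 0`), `‖S y‖ ≤ a‖y‖²` for `‖y‖ < ρ` and `‖S y‖ ≤ b`
everywhere, then `‖K y • S y‖ ≤ A a ‖y‖⁻²` on `B_ρ` and `≤ A b ‖y‖⁻⁴` off `B_ρ`. [folklore] -/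
private theorem norm_smul_le_ballIndicator {F : Type*} [SeminormedAddCommGroup F] [NormedSpace ℂ F]
    {K : EuclideanSpace ℝ (Fin 3) → ℝ} {A : ℝ} (hA : 0 ≤ A) (hK : ∀ y, |K y| ≤ A * (‖y‖ ^ 4)⁻¹)
    {S : EuclideanSpace ℝ (Fin 3) → F} {ρ a b : ℝ} (hnear : ∀ y, ‖y‖ < ρ → ‖S y‖ ≤ a * ‖y‖ ^ 2)
    (hfar : ∀ y, ‖S y‖ ≤ b) (y : EuclideanSpace ℝ (Fin 3)) :
    ‖(K y : ℂ) • S y‖ ≤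
      (ball (0 : EuclideanSpace ℝ (Fin 3)) ρ).indicator (fun y => A * a * ‖y‖ ^ (-(2 : ℝ))) y +
        (ball (0 : EuclideanSpace ℝ (Fin 3)) ρ)ᶜ.indicator (fun y => A * b * ‖y‖ ^ (-(4 : ℝ))) y := by
  rw [norm_smul, Complex.norm_real, Real.norm_eq_abs]
  by_cases hy : y ∈ ball (0 : EuclideanSpace ℝ (Fin 3)) ρ
  · rw [indicator_of_mem hy, indicator_of_notMem (notMem_compl_iff.2 hy), add_zero]
    have hy' : ‖y‖ < ρ := mem_ball_zero_iff.1 hy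
    by_cases hy0 : y = 0
    · subst hy0
      have hK0 : K 0 = 0 := by
        have h := hK 0
        simp only [norm_zero, ne_eq, OfNat.ofNat_ne_zero, not_false_eq_true, zero_pow, inv_zero,
          mul_zero] at h
        exact abs_nonpos_iff.mp h
      simp only [hK0, abs_zero, zero_mul, norm_zero, Real.zero_rpow (by norm_num : (-(2 : ℝ)) ≠ 0),
        mul_zero, le_refl]
    have hn : ‖y‖ ≠ 0 := norm_ne_zero_iff.2 hy0
    calc |K y| * ‖S y‖ ≤ (A * (‖y‖ ^ 4)⁻¹) * (a * ‖y‖ ^ 2) :=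
          mul_le_mul (hK y) (hnear y hy') (norm_nonneg _) (by positivity)
      _ = A * a * ‖y‖ ^ (-(2 : ℝ)) := by
          rw [Real.rpow_neg (norm_nonneg _), Real.rpow_two]
          field_simp
  · rw [indicator_of_notMem hy, indicator_of_mem (mem_compl hy), zero_add]
    calc |K y| * ‖S y‖ ≤ (A * (‖y‖ ^ 4)⁻¹) * b :=
          mul_le_mul (hK y) (hfar y) (norm_nonneg _) (by positivity)
      _ = A * b * ‖y‖ ^ (-(4 : ℝ)) := by
          rw [Real.rpow_neg (norm_nonneg _), Real.rpow_ofNat]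
          ring

end Majorant

/-! ### The tube extension of the second-difference integral -/

section Main

variable {κ : Type*} [Fintype κ]

/-- Measurability in `y` of `y ↦ W (z + y)` / `W (z − y)` for `W` continuous on a tube containing `z`
(real shifts stay in the tube). [folklore] -/
private theorem continuous_comp_add_complexify {F : Type*} [TopologicalSpace F] {ρ : ℝ}
    {W : EuclideanSpace ℂ (Fin 3) → F} (hW : ContinuousOn W (complexTube (Fin 3) ρ))
    {z : EuclideanSpace ℂ (Fin 3)} (hz : z ∈ complexTube (Fin 3) ρ) :
    Continuous (fun y : EuclideanSpace ℝ (Fin 3) => W (z + complexify y)) ∧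
      Continuous (fun y : EuclideanSpace ℝ (Fin 3) => W (z - complexify y)) :=
  ⟨hW.comp_continuous (continuous_const.add continuous_complexify)
      fun y => add_complexify_mem_complexTube hz y,
    hW.comp_continuous (continuous_const.sub continuous_complexify)
      fun y => sub_complexify_mem_complexTube hz y⟩

/-- **Second-difference integrals preserve bounded tube holomorphy.**  For every `r > 0` there is
`C` (depending only on `r`) such that: if `K : ℝ³ → ℝ` is measurable with `|K z| ≤ A‖z‖⁻⁴` (`A ≥ 0`),
`U : ℂ³ → ℂ^κ` is holomorphic on the tube `complexTube (Fin 3) r` with `‖U‖ ≤ B` there and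
`U (complexify x) = complexify (f x)` on `ℝ³`, then there is `V : ℂ³ → ℂ^κ` holomorphic on the half
tube `complexTube (Fin 3) (r/2)` with `V (complexify x) = complexify (∫ K z • (2 f x − f (x+z) − f (x−z)) dz)`
for all `x`, the real integrand being integrable for every `x`, and `‖V‖ ≤ C·A·B` on the half tube.
(Folklore; the proof is Cauchy's inequalities on complex lines in the tube plus dominated
differentiation under the integral sign; the complexified-extension frame `U (complexify x) = complexify (f x)`
on `complexTube` is the one of Grujić–Kukavica / Guberović, cf. the tree's `guberovic2010_analyticity_radius`,
which supplies the tube datum in the Navier–Stokes application.)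
[cite: HormanderSCV1973, Thm 2.2.7 (Cauchy's inequalities; the tube-stability statement itself is folklore)] -/
theorem exists_tube_extension_secondDiffIntegral {r : ℝ} (hr : 0 < r) :
    ∃ C : ℝ, ∀ {A B : ℝ} {K : EuclideanSpace ℝ (Fin 3) → ℝ}
      {U : EuclideanSpace ℂ (Fin 3) → EuclideanSpace ℂ κ}
      {f : EuclideanSpace ℝ (Fin 3) → EuclideanSpace ℝ κ},
      0 ≤ A → Measurable K → (∀ y, |K y| ≤ A * (‖y‖ ^ 4)⁻¹) →
      DifferentiableOn ℂ U (complexTube (Fin 3) r) →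
      (∀ x, U (complexify x) = complexify (f x)) →
      (∀ z ∈ complexTube (Fin 3) r, ‖U z‖ ≤ B) →
      ∃ V : EuclideanSpace ℂ (Fin 3) → EuclideanSpace ℂ κ,
        DifferentiableOn ℂ V (complexTube (Fin 3) (r / 2)) ∧
        (∀ x, V (complexify x) = complexify (∫ y, K y • ((2 : ℝ) • f x - f (x + y) - f (x - y)))) ∧
        (∀ x, Integrable (fun y => K y • ((2 : ℝ) • f x - f (x + y) - f (x - y))) volume) ∧
        ∀ z ∈ complexTube (Fin 3) (r / 2), ‖V z‖ ≤ C * A * B := by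
  -- the shape of the majorant on the half tube: near radius `r/8`, `a = 64/r²`, `b = 4`
  refine ⟨∫ y, ((ball (0 : EuclideanSpace ℝ (Fin 3)) (r / 8)).indicator
      (fun y => 64 / r ^ 2 * ‖y‖ ^ (-(2 : ℝ))) y +
      (ball (0 : EuclideanSpace ℝ (Fin 3)) (r / 8))ᶜ.indicator (fun y => 4 * ‖y‖ ^ (-(4 : ℝ))) y), ?_⟩
  intro A B K U f hA hKm hK hU hUf hB
  have hr2 : 0 < r / 2 := by positivity
  have hr8 : 0 < r / 8 := by positivity
  have hB0 : 0 ≤ B := by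
    have := hB _ (complexify_mem_complexTube hr 0)
    exact (norm_nonneg _).trans this
  have hUan : AnalyticOnNhd ℂ U (complexTube (Fin 3) r) :=
    Literature.Analysis.Complex.analyticOnNhd_of_differentiableOn_of_finiteDimensional
      (isOpen_complexTube r) hU
  have hUc : ContinuousOn U (complexTube (Fin 3) r) := hU.continuousOn
  have hDUd : DifferentiableOn ℂ (fderiv ℂ U) (complexTube (Fin 3) r) := hUan.fderiv.differentiableOn
  have hDUc : ContinuousOn (fderiv ℂ U) (complexTube (Fin 3) r) := hUan.fderiv.continuousOn
  have hKm' : Measurable fun y : EuclideanSpace ℝ (Fin 3) => (K y : ℂ) :=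
    Complex.continuous_ofReal.measurable.comp hKm
  -- the integrand and its majorant on the half tube
  set G : EuclideanSpace ℂ (Fin 3) → EuclideanSpace ℝ (Fin 3) → EuclideanSpace ℂ κ :=
    fun z y => (K y : ℂ) • ((2 : ℂ) • U z - U (z + complexify y) - U (z - complexify y)) with hG
  have hGm : ∀ z ∈ complexTube (Fin 3) r, AEStronglyMeasurable (G z) volume := by
    intro z hz
    obtain ⟨h1, h2⟩ := continuous_comp_add_complexify hUc hz
    exact hKm'.aestronglyMeasurable.smul ((continuous_const.sub h1).sub h2).aestronglyMeasurable
  have hGle : ∀ z ∈ complexTube (Fin 3) (r / 2), ∀ y, ‖G z y‖ ≤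
      (ball (0 : EuclideanSpace ℝ (Fin 3)) (r / 8)).indicator
          (fun y => A * (64 * B / r ^ 2) * ‖y‖ ^ (-(2 : ℝ))) y +
        (ball (0 : EuclideanSpace ℝ (Fin 3)) (r / 8))ᶜ.indicator (fun y => A * (4 * B) * ‖y‖ ^ (-(4 : ℝ))) y := by
    intro z hz y
    show ‖(K y : ℂ) • ((2 : ℂ) • U z - U (z + complexify y) - U (z - complexify y))‖ ≤ _
    refine norm_smul_le_ballIndicator (F := EuclideanSpace ℂ κ) hA hK
      (S := fun y' => (2 : ℂ) • U z - U (z + complexify y') - U (z - complexify y'))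
      (fun y' hy' => ?_) (fun y' => ?_) y
    · have h := norm_secondDiff_le_of_tube (half_lt_self hr) hU hB hz (y := y')
        (by linarith [hy'.le])
      refine h.trans (le_of_eq ?_)
      field_simp
      ring
    · have hzr : z ∈ complexTube (Fin 3) r := complexTube_mono (half_le_self hr.le) hz
      calc ‖(2 : ℂ) • U z - U (z + complexify y') - U (z - complexify y')‖
          ≤ ‖(2 : ℂ) • U z‖ + ‖U (z + complexify y')‖ + ‖U (z - complexify y')‖ :=
            (norm_sub_le _ _).trans (add_le_add (norm_sub_le _ _) le_rfl)
        _ ≤ 2 * B + B + B := by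
            refine add_le_add (add_le_add ?_ (hB _ (add_complexify_mem_complexTube hzr y')))
              (hB _ (sub_complexify_mem_complexTube hzr y'))
            rw [norm_smul, RCLike.norm_ofNat (K := ℂ)]
            exact mul_le_mul_of_nonneg_left (hB z hzr) zero_le_two
        _ = 4 * B := by ring
  have hmaj := integrable_ballIndicator_rpow_neg (A * (64 * B / r ^ 2)) (A * (4 * B)) hr8
  have hGint : ∀ z ∈ complexTube (Fin 3) (r / 2), Integrable (G z) volume := fun z hz =>
    hmaj.mono' (hGm z (complexTube_mono (half_le_self hr.le) hz)) (ae_of_all _ (hGle z hz))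
  -- values at real points, pointwise
  have hpt : ∀ x y, G (complexify x) y = complexify (K y • ((2 : ℝ) • f x - f (x + y) - f (x - y))) := by
    intro x y
    simp only [hG]
    rw [← map_add, ← map_sub complexify x y, hUf, hUf, hUf, complexify_smul_real, map_sub, map_sub,
      complexify_smul_real]
    push_cast
    rfl
  -- `f` is continuous (restriction of the continuous `U` along the isometric embedding `complexify`)
  have hfc : Continuous f := by
    have hemb : IsEmbedding (complexify : EuclideanSpace ℝ κ → EuclideanSpace ℂ κ) :=
      (complexify : EuclideanSpace ℝ κ →ₗᵢ[ℝ] EuclideanSpace ℂ κ).isometry.isEmbedding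
    rw [hemb.continuous_iff]
    exact (hUc.comp_continuous continuous_complexify fun x => complexify_mem_complexTube hr x).congr
      fun x => hUf x
  -- the extension
  refine ⟨fun z => ∫ y, G z y, ?_, ?_, ?_, ?_⟩
  · -- holomorphy: differentiate under the integral sign
    intro z₀ hz₀
    obtain ⟨x₀, y₀, hy₀, hz₀e⟩ := hz₀
    -- radii: z₀ ∈ T_{ρ'} ⊂ ball z₀ δ ⊂ T_{ρ₂}, ρ₂ < r/2
    set ρ' := (‖y₀‖ + r / 2) / 2 with hρ'
    have hρ'lt : ρ' < r / 2 := by rw [hρ']; linarith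
    have hy₀ρ' : ‖y₀‖ < ρ' := by rw [hρ']; linarith
    set δ := (r / 2 - ρ') / 2 with hδ
    have hδ0 : 0 < δ := by rw [hδ]; linarith
    set ρ₂ := ρ' + δ with hρ₂
    have hρ₂lt : ρ₂ < r / 2 := by rw [hρ₂, hδ]; linarith
    have hz₀ρ' : z₀ ∈ complexTube (Fin 3) ρ' := ⟨x₀, y₀, hy₀ρ', hz₀e⟩
    have hball : ∀ z ∈ ball z₀ δ, z ∈ complexTube (Fin 3) ρ₂ := by
      intro z hz
      have h := add_mem_complexTube_of_norm_lt hz₀ρ' (mem_ball_iff_norm.1 hz)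
      rwa [add_sub_cancel] at h
    -- the derivative data: `DU` on `T_{r/2}` is bounded by `M = 4B/r`
    set M := 2 * B / (r - r / 2) with hM
    have hM0 : 0 ≤ M := by rw [hM]; exact div_nonneg (by positivity) (by linarith)
    have hDUb : ∀ z ∈ complexTube (Fin 3) (r / 2), ‖fderiv ℂ U z‖ ≤ M := fun z hz =>
      norm_fderiv_le_of_tube (half_lt_self hr) hU hB hz
    have hDUd' : DifferentiableOn ℂ (fderiv ℂ U) (complexTube (Fin 3) (r / 2)) :=
      hDUd.mono (complexTube_mono (half_le_self hr.le))
    set G' : EuclideanSpace ℂ (Fin 3) → EuclideanSpace ℝ (Fin 3) →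
        (EuclideanSpace ℂ (Fin 3) →L[ℂ] EuclideanSpace ℂ κ) :=
      fun z y => (K y : ℂ) • ((2 : ℂ) • fderiv ℂ U z - fderiv ℂ U (z + complexify y) -
        fderiv ℂ U (z - complexify y)) with hG'
    have hρ₃ : 0 < (r / 2 - ρ₂) / 4 := by linarith
    have hmaj' := integrable_ballIndicator_rpow_neg (A * (16 * M / (r / 2 - ρ₂) ^ 2)) (A * (4 * M)) hρ₃
    have hG'le : ∀ z ∈ ball z₀ δ, ∀ y, ‖G' z y‖ ≤
        (ball (0 : EuclideanSpace ℝ (Fin 3)) ((r / 2 - ρ₂) / 4)).indicator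
            (fun y => A * (16 * M / (r / 2 - ρ₂) ^ 2) * ‖y‖ ^ (-(2 : ℝ))) y +
          (ball (0 : EuclideanSpace ℝ (Fin 3)) ((r / 2 - ρ₂) / 4))ᶜ.indicator
            (fun y => A * (4 * M) * ‖y‖ ^ (-(4 : ℝ))) y := by
      intro z hz y
      have hz₂ := hball z hz
      show ‖(K y : ℂ) • ((2 : ℂ) • fderiv ℂ U z - fderiv ℂ U (z + complexify y) -
        fderiv ℂ U (z - complexify y))‖ ≤ _
      refine norm_smul_le_ballIndicator (F := EuclideanSpace ℂ (Fin 3) →L[ℂ] EuclideanSpace ℂ κ) hA hK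
        (S := fun y' => (2 : ℂ) • fderiv ℂ U z - fderiv ℂ U (z + complexify y') -
          fderiv ℂ U (z - complexify y')) (fun y' hy' => ?_) (fun y' => ?_) y
      · have h := norm_secondDiff_le_of_tube hρ₂lt hDUd' hDUb hz₂ (y := y') hy'.le
        refine h.trans (le_of_eq ?_)
        ring
      · have hzr : z ∈ complexTube (Fin 3) (r / 2) := complexTube_mono hρ₂lt.le hz₂
        calc ‖(2 : ℂ) • fderiv ℂ U z - fderiv ℂ U (z + complexify y') - fderiv ℂ U (z - complexify y')‖
            ≤ ‖(2 : ℂ) • fderiv ℂ U z‖ + ‖fderiv ℂ U (z + complexify y')‖ +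
                ‖fderiv ℂ U (z - complexify y')‖ :=
              (norm_sub_le _ _).trans (add_le_add (norm_sub_le _ _) le_rfl)
          _ ≤ 2 * M + M + M := by
              refine add_le_add (add_le_add ?_ (hDUb _ (add_complexify_mem_complexTube hzr y')))
                (hDUb _ (sub_complexify_mem_complexTube hzr y'))
              rw [norm_smul, RCLike.norm_ofNat (K := ℂ)]
              exact mul_le_mul_of_nonneg_left (hDUb z hzr) zero_le_two
          _ = 4 * M := by ring
    have hz₀r2 : z₀ ∈ complexTube (Fin 3) (r / 2) := complexTube_mono hρ'lt.le hz₀ρ'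
    have hz₀r : z₀ ∈ complexTube (Fin 3) r := complexTube_mono (half_le_self hr.le) hz₀r2
    have hkey : HasFDerivAt (fun z => ∫ y, G z y) (∫ y, G' z₀ y) z₀ := by
      refine hasFDerivAt_integral_of_dominated_of_fderiv_le (𝕜 := ℂ) (ball_mem_nhds z₀ hδ0)
        ?_ (hGint z₀ hz₀r2) ?_ (ae_of_all _ fun y z hz => hG'le z hz y) hmaj' ?_
      · exact Filter.eventually_of_mem ((isOpen_complexTube r).mem_nhds hz₀r) hGm
      · obtain ⟨h1, h2⟩ := continuous_comp_add_complexify hDUc hz₀r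
        exact hKm'.aestronglyMeasurable.smul ((continuous_const.sub h1).sub h2).aestronglyMeasurable
      · refine ae_of_all _ fun y z hz => ?_
        have hzr : z ∈ complexTube (Fin 3) r :=
          complexTube_mono (by linarith) (hball z hz)
        have hd : ∀ w ∈ complexTube (Fin 3) r, HasFDerivAt U (fderiv ℂ U w) w := fun w hw =>
          (hU.differentiableAt ((isOpen_complexTube r).mem_nhds hw)).hasFDerivAt
        have h0 := hd z hzr
        have h1 : HasFDerivAt (fun z => U (z + complexify y)) (fderiv ℂ U (z + complexify y)) z := by
          have hc := (hd _ (add_complexify_mem_complexTube hzr y)).comp z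
            ((hasFDerivAt_id z).add_const (complexify y))
          rw [ContinuousLinearMap.comp_id] at hc
          exact hc
        have h2 : HasFDerivAt (fun z => U (z - complexify y)) (fderiv ℂ U (z - complexify y)) z := by
          have hc := (hd _ (sub_complexify_mem_complexTube hzr y)).comp z
            ((hasFDerivAt_id z).sub_const (complexify y))
          rw [ContinuousLinearMap.comp_id] at hc
          exact hc
        exact (((h0.const_smul (2 : ℂ)).sub h1).sub h2).const_smul (K y : ℂ)
    exact hkey.differentiableAt.differentiableWithinAt
  · -- real points
    intro x
    show ∫ y, G (complexify x) y = _
    simp_rw [hpt x]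
    exact (complexify : EuclideanSpace ℝ κ →ₗᵢ[ℝ] EuclideanSpace ℂ κ).integral_comp_comm _
  · -- integrability of the real integrand
    intro x
    have hmeas : AEStronglyMeasurable
        (fun y => K y • ((2 : ℝ) • f x - f (x + y) - f (x - y))) volume :=
      hKm.aestronglyMeasurable.smul
        ((continuous_const.sub (hfc.comp (continuous_const.add continuous_id))).sub
          (hfc.comp (continuous_const.sub continuous_id))).aestronglyMeasurable
    refine (hGint _ (complexify_mem_complexTube hr2 x)).norm.mono' hmeas (ae_of_all _ fun y => ?_)
    rw [← norm_complexify (K y • ((2 : ℝ) • f x - f (x + y) - f (x - y))), ← hpt x y]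
  · -- the bound
    intro z hz
    have hsplit : ∀ y : EuclideanSpace ℝ (Fin 3),
        (ball (0 : EuclideanSpace ℝ (Fin 3)) (r / 8)).indicator
            (fun y => A * (64 * B / r ^ 2) * ‖y‖ ^ (-(2 : ℝ))) y +
          (ball (0 : EuclideanSpace ℝ (Fin 3)) (r / 8))ᶜ.indicator
            (fun y => A * (4 * B) * ‖y‖ ^ (-(4 : ℝ))) y =
        (A * B) * ((ball (0 : EuclideanSpace ℝ (Fin 3)) (r / 8)).indicator
            (fun y => 64 / r ^ 2 * ‖y‖ ^ (-(2 : ℝ))) y +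
          (ball (0 : EuclideanSpace ℝ (Fin 3)) (r / 8))ᶜ.indicator (fun y => 4 * ‖y‖ ^ (-(4 : ℝ))) y) := by
      intro y
      by_cases hy : y ∈ ball (0 : EuclideanSpace ℝ (Fin 3)) (r / 8)
      · rw [indicator_of_mem hy, indicator_of_mem hy, indicator_of_notMem (notMem_compl_iff.2 hy),
          indicator_of_notMem (notMem_compl_iff.2 hy)]
        ring
      · rw [indicator_of_notMem hy, indicator_of_notMem hy, indicator_of_mem (mem_compl hy),
          indicator_of_mem (mem_compl hy)]
        ring
    calc ‖∫ y, G z y‖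
        ≤ ∫ y, ((ball (0 : EuclideanSpace ℝ (Fin 3)) (r / 8)).indicator
              (fun y => A * (64 * B / r ^ 2) * ‖y‖ ^ (-(2 : ℝ))) y +
            (ball (0 : EuclideanSpace ℝ (Fin 3)) (r / 8))ᶜ.indicator
              (fun y => A * (4 * B) * ‖y‖ ^ (-(4 : ℝ))) y) :=
          norm_integral_le_of_norm_le hmaj (ae_of_all _ (hGle z hz))
      _ = (A * B) * ∫ y, ((ball (0 : EuclideanSpace ℝ (Fin 3)) (r / 8)).indicator
              (fun y => 64 / r ^ 2 * ‖y‖ ^ (-(2 : ℝ))) y +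
            (ball (0 : EuclideanSpace ℝ (Fin 3)) (r / 8))ᶜ.indicator (fun y => 4 * ‖y‖ ^ (-(4 : ℝ))) y) := by
          rw [← integral_const_mul]
          exact integral_congr_ae (ae_of_all _ hsplit)
      _ = _ := by ring

/-! ### Real-analyticity of the restriction -/

/-- A real-linear left inverse of `complexify : ℝ^κ → ℂ^κ` (coordinatewise real part), as a
continuous linear map. [folklore] -/
private theorem exists_clm_leftInverse_complexify :
    ∃ P : EuclideanSpace ℂ κ →L[ℝ] EuclideanSpace ℝ κ, ∀ v : EuclideanSpace ℝ κ, P (complexify v) = v := by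
  let L : EuclideanSpace ℂ κ →ₗ[ℝ] EuclideanSpace ℝ κ :=
    { toFun := fun w => WithLp.toLp 2 fun i => (w i).re
      map_add' := fun v w => by ext i; simp
      map_smul' := fun t w => by ext i; simp }
  have hL : ∀ w, ‖L w‖ ≤ 1 * ‖w‖ := by
    intro w
    rw [one_mul, EuclideanSpace.norm_eq (L w), EuclideanSpace.norm_eq w]
    refine Real.sqrt_le_sqrt (Finset.sum_le_sum fun i _ => ?_)
    simp only [L, LinearMap.coe_mk, AddHom.coe_mk, PiLp.toLp_apply, Real.norm_eq_abs]
    exact pow_le_pow_left₀ (abs_nonneg _) (Complex.abs_re_le_norm _) 2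
  refine ⟨L.mkContinuous 1 hL, fun v => ?_⟩
  ext i
  simp [L, complexify_apply]

/-- **Real-analyticity of second-difference integrals of tube-holomorphic maps.**  Under the
hypotheses of `exists_tube_extension_secondDiffIntegral` (measurable kernel `|K z| ≤ A‖z‖⁻⁴` on `ℝ³`,
`A ≥ 0`; `f : ℝ³ → ℝ^κ` the restriction of a map holomorphic and bounded on the tube
`complexTube (Fin 3) r`, `r > 0`), the map `x ↦ c • ∫ K z • (2 f x − f (x+z) − f (x−z)) dz` is
real-analytic on all of `ℝ³`, for every real constant `c` (`c = 1/2`, `K = π⁻²‖z‖⁻⁴` is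
`Λ = (−Δ)^{1/2}` in second-difference form).  Proof: the tube extension `V` is holomorphic on the open
half tube, hence analytic (vector-valued Osgood), hence real-analytic after restricting scalars and
composing with the real-linear isometric embedding `complexify` and its left inverse.
[cite: HormanderSCV1973, Thm 2.2.7 and Thm 2.2.1/2.2.6 (Cauchy's inequalities; holomorphic ⇒ analytic); the tube-stability statement itself is folklore] -/
theorem analyticOnNhd_secondDiffIntegral_of_tube {r A B : ℝ} (hr : 0 < r) (hA : 0 ≤ A)
    {K : EuclideanSpace ℝ (Fin 3) → ℝ} (hKm : Measurable K) (hK : ∀ y, |K y| ≤ A * (‖y‖ ^ 4)⁻¹)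
    {U : EuclideanSpace ℂ (Fin 3) → EuclideanSpace ℂ κ} {f : EuclideanSpace ℝ (Fin 3) → EuclideanSpace ℝ κ}
    (hU : DifferentiableOn ℂ U (complexTube (Fin 3) r)) (hUf : ∀ x, U (complexify x) = complexify (f x))
    (hB : ∀ z ∈ complexTube (Fin 3) r, ‖U z‖ ≤ B) (c : ℝ) :
    AnalyticOnNhd ℝ (fun x => c • ∫ y, K y • ((2 : ℝ) • f x - f (x + y) - f (x - y))) univ := by
  obtain ⟨C, hC⟩ := exists_tube_extension_secondDiffIntegral (κ := κ) hr
  obtain ⟨V, hVd, hVf, -, -⟩ := hC hA hKm hK hU hUf hB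
  have hVan : AnalyticOnNhd ℂ V (complexTube (Fin 3) (r / 2)) :=
    Literature.Analysis.Complex.analyticOnNhd_of_differentiableOn_of_finiteDimensional
      (isOpen_complexTube _) hVd
  obtain ⟨P, hP⟩ := exists_clm_leftInverse_complexify (κ := κ)
  intro x _
  have hcx : complexify x ∈ complexTube (Fin 3) (r / 2) := complexify_mem_complexTube (half_pos hr) x
  have h1 : AnalyticAt ℝ (fun x' : EuclideanSpace ℝ (Fin 3) => V (complexify x')) x :=
    ((hVan _ hcx).restrictScalars (𝕜 := ℝ)).comp
      ((complexify : EuclideanSpace ℝ (Fin 3) →ₗᵢ[ℝ] EuclideanSpace ℂ (Fin 3)).toContinuousLinearMap.analyticAt x)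
  have h2 : AnalyticAt ℝ (fun x' : EuclideanSpace ℝ (Fin 3) => P (V (complexify x'))) x :=
    (P.analyticAt _).comp h1
  have heq : (fun x' : EuclideanSpace ℝ (Fin 3) =>
      c • ∫ y, K y • ((2 : ℝ) • f x' - f (x' + y) - f (x' - y))) =
      c • fun x' => P (V (complexify x')) := by
    funext x'
    rw [Pi.smul_apply, hVf, hP]
  rw [heq]
  exact h2.const_smul

/-- **The case of `Λ = (−Δ)^{1/2}` on `ℝ³` in second-difference form**,
`Λ f (x) = ½ ∫ π⁻² ‖z‖⁻⁴ (2 f x − f (x+z) − f (x−z)) dz` (Di Nezza–Palatucci–Valdinoci 2012, Lemma 3.2: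
`(−Δ)^s u(x) = −½ C(n,s) ∫ (u(x+y) + u(x−y) − 2u(x)) |y|^{−n−2s} dy`, here `n = 3`, `s = ½`,
`C(3,½) = π⁻²`): if `f : ℝ³ → ℝ^κ` is the restriction of a map holomorphic and bounded on a tube
`complexTube (Fin 3) r`, `r > 0`, then `Λ f` is real-analytic on all of `ℝ³` (the kernel written
exactly as `(1 / π ^ 2) * (‖z‖ ^ 4)⁻¹`, so that second-difference definitions of `Λ` with this kernel
match by `rfl`). [cite: DinezzaPalatucciValdinoci2012, Lemma 3.2 (second-difference form of `(−Δ)^s`)] -/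
theorem analyticOnNhd_fracLaplacianHalf_secondDiff_of_tube {r B : ℝ} (hr : 0 < r)
    {U : EuclideanSpace ℂ (Fin 3) → EuclideanSpace ℂ κ} {f : EuclideanSpace ℝ (Fin 3) → EuclideanSpace ℝ κ}
    (hU : DifferentiableOn ℂ U (complexTube (Fin 3) r)) (hUf : ∀ x, U (complexify x) = complexify (f x))
    (hB : ∀ z ∈ complexTube (Fin 3) r, ‖U z‖ ≤ B) :
    AnalyticOnNhd ℝ (fun x => (1 / 2 : ℝ) • ∫ y, ((1 / Real.pi ^ 2) * (‖y‖ ^ 4)⁻¹) •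
      ((2 : ℝ) • f x - f (x + y) - f (x - y))) univ :=
  analyticOnNhd_secondDiffIntegral_of_tube hr (A := 1 / Real.pi ^ 2) (by positivity)
    (K := fun y => (1 / Real.pi ^ 2) * (‖y‖ ^ 4)⁻¹) (by fun_prop)
    (fun y => by rw [abs_of_nonneg (by positivity)]) hU hUf hB (1 / 2)

end Main

end Literature.Analysis.FluidPDE
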